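import Summits.AtomisticToContinuum.Crystallization.Theorems.PalmUnimodularRigidityMinimiserShellsCapAssemblyA

/-!
# Cap assembly, part B: the pointwise certificate with an extra transport
(line `octahedral-annulus-mandate` of crux `MinimiserShells`, stmt-AtomisticToContinuum-9225; lemma for
stub `stub_capAssembly`)

Route `PalmUnimodularRigidity`, crux decl
`Summit.AtomisticToContinuum.Crystallization.Theses.PalmUnimodularRigidity.MinimiserShells`.

`certificate` is `SlackCertificates.certificate_at` with one extra transport `G` riding along: for a rooted
`δ`-hard-core configuration `μ`, a jointly measurable `G` bounded by `K` on rooted hard-core inputs and of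
range `2L`, and the transfer `t = −vol⁻¹·(min(transport δ L, M_b) + min(G, K))` (the `min`s are inactive on
`μ` and on its re-rootings), the divergence `∫ (t(μ,y) − t(θ_y μ, −y)) dμ` is
`vol⁻¹·((IN_F + IN_G) − (OUT_F + OUT_G))` (four bounded integrands supported in `B̄(0, 2L)`, Bochner =
`toReal` of `lintegral`); with OUT_F `≤ vol·(h + C_δ) + U/12` (`lintegral_transport_eq`,
`setLIntegral_ofReal_locEnergy_le`, `errTerm_le_uniform`) and the hypothesis IN_F `≥ vol·(e* + C_δ) + OUT_G`
this gives `h + div t ≥ e* − U/(12·vol) + vol⁻¹·IN_G`.  Part C (`…CapAssembly.lean`) runs it with `G` the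
defect transport of the line.
-/

noncomputable section

open MeasureTheory Filter Set
open scoped ENNReal BigOperators Topology

namespace Summit.AtomisticToContinuum.Crystallization.Theorems.PalmUnimodularRigidityMinimiserShells.CapAssembly

open Literature.Probability.Process (IsRootedHardCore count_restrict_singleton_ne_zero_iff)
open Literature.MathematicalPhysics.StatisticalMechanics (lennardJones rootEnergy)
open Summit.AtomisticToContinuum.Crystallization.Theorems.MinimiserShells.Negative.LoadBearing (eStar)
open Summit.AtomisticToContinuum.Crystallization.Theorems.MinimiserShells.Negative.Rootedness (E3 countable_of_separated)
open Summit.AtomisticToContinuum.Crystallization.Theorems.PalmUnimodularRigidityMinimiserShells.EnergyFloor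
open Summit.AtomisticToContinuum.Crystallization.Theorems.PalmUnimodularRigidityMinimiserShells.SlackCertificates
  (errTerm_le_uniform transport_le_of_hc transport_eq_zero_of_lt measurable_transport_map_sub)

/-! ## The pointwise certificate with an extra transport -/

/-- **The random-grid transport plus an extra transport `G` is a pointwise certificate.**  Fix `δ > 0`, a
mesh `L > 0`, a cut-off `ρ ≥ δ`, `vol = vol [0,1)³`, `M_b = vol·(250/24·δ⁻¹² + C_δ)`, a jointly measurable
`G` bounded by `K < ∞` on rooted `δ`-hard-core inputs and vanishing beyond `2L`, and
`U = 6(ρ/L)·250 δ⁻⁶ + vol·1000 δ⁻⁴ ρ⁻²`.  If at the rooted `δ`-hard-core configuration `μ` the mass received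
through the grid transport pays for `vol·(e* + C_δ)` plus the `G`-mass sent, then the transfer
`t = −vol⁻¹·(min(transport, M_b) + min(G, K))` satisfies
`e* − U/(12·vol) + vol⁻¹·(G-mass received) ≤ h(μ) + ∫ (t(μ,y) − t(θ_y μ, −y)) dμ(y)`. -/
theorem certificate {δ L ρ : ℝ} (hδ : 0 < δ) (hL : 0 < L) (hδρ : δ ≤ ρ) {μ : Measure E3}
    (hμ : IsRootedHardCore δ μ) {G : Measure E3 → E3 → ℝ≥0∞} {K : ℝ≥0∞} (hKtop : K ≠ ∞)
    (hGm : Measurable (Function.uncurry G))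
    (hGle : ∀ ν : Measure E3, IsRootedHardCore δ ν → ∀ y, G ν y ≤ K)
    (hG0 : ∀ (ν : Measure E3) (y : E3), 2 * L < ‖y‖ → G ν y = 0)
    (hIN : volume phaseDom * ENNReal.ofReal (eStar + cst δ) + ∫⁻ y, G μ y ∂μ ≤
      ∫⁻ y, transport δ L (μ.map fun z => z - y) (-y) ∂μ) :
    eStar - (6 * (ρ / L) * (250 * δ⁻¹ ^ 6) + (volume phaseDom).toReal * (1000 * δ⁻¹ ^ 4 * ρ⁻¹ ^ 2)) /
        (12 * (volume phaseDom).toReal) +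
      ((volume phaseDom).toReal)⁻¹ * (∫⁻ y, G (μ.map fun z => z - y) (-y) ∂μ).toReal ≤
      rootEnergy lennardJones μ +
        ∫ y, ((-(((volume phaseDom).toReal)⁻¹ *
                (min (transport δ L μ y).toReal
                  ((volume phaseDom * ENNReal.ofReal (250 / 24 * δ⁻¹ ^ 12 + cst δ)).toReal) +
                 min (G μ y).toReal K.toReal))) -
              (-(((volume phaseDom).toReal)⁻¹ *
                (min (transport δ L (Measure.map (fun z => z - y) μ) (-y)).toReal
                  ((volume phaseDom * ENNReal.ofReal (250 / 24 * δ⁻¹ ^ 12 + cst δ)).toReal) +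
                 min (G (Measure.map (fun z => z - y) μ) (-y)).toReal K.toReal)))) ∂μ := by
  -- names
  set D : ℝ≥0∞ := volume phaseDom with hD
  set Bδ : ℝ≥0∞ := ENNReal.ofReal (250 / 24 * δ⁻¹ ^ 12 + cst δ) with hBδ
  set Mb : ℝ := (D * Bδ).toReal with hMb
  set Kr : ℝ := K.toReal with hKr
  set d : ℝ := D.toReal with hd
  have hDne0 : D ≠ 0 := volume_phaseDom_ne_zero
  have hDtop : D ≠ ∞ := volume_phaseDom_ne_top
  have hdpos : 0 < d := ENNReal.toReal_pos hDne0 hDtop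
  have hDBtop : D * Bδ ≠ ∞ := ENNReal.mul_ne_top hDtop ENNReal.ofReal_ne_top
  have hρ : 0 ≤ ρ := hδ.le.trans hδρ
  -- the configuration
  have hμ' := hμ
  obtain ⟨S, -, hsep, rfl⟩ := hμ
  set μ : Measure E3 := (Measure.count : Measure E3).restrict S with hμdef
  have hS : S.Countable := countable_of_separated hδ hsep
  have hSm : MeasurableSet S := hS.measurableSet
  have hmem : μ ∈ hcClass δ := mem_hcClass_of_hc hδ hμ'
  have hpt : ∀ y ∈ S, IsRootedHardCore δ (μ.map fun z => z - y) := fun y hy =>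
    hμ'.map_sub ((count_restrict_singleton_ne_zero_iff S y).2 hy)
  -- bounds on the transports, sent and received
  have hsent_le : ∀ y, transport δ L μ y ≤ D * Bδ := fun y => transport_le_of_hc hδ hμ' y
  have hrecv_le : ∀ y ∈ S, transport δ L (μ.map fun z => z - y) (-y) ≤ D * Bδ := fun y hy =>
    transport_le_of_hc hδ (hpt y hy) _
  have hGsent_le : ∀ y, G μ y ≤ K := hGle μ hμ'
  have hGrecv_le : ∀ y ∈ S, G (μ.map fun z => z - y) (-y) ≤ K := fun y hy => hGle _ (hpt y hy) _
  have hsent_zero : ∀ y : E3, 2 * L < ‖y‖ → transport δ L μ y = 0 := fun y hy =>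
    transport_eq_zero_of_lt hL μ hy
  have hrecv_zero : ∀ y : E3, 2 * L < ‖y‖ → transport δ L (μ.map fun z => z - y) (-y) = 0 := fun y hy =>
    transport_eq_zero_of_lt hL _ (by rwa [norm_neg])
  have hGsent_zero : ∀ y : E3, 2 * L < ‖y‖ → G μ y = 0 := fun y hy => hG0 μ y hy
  have hGrecv_zero : ∀ y : E3, 2 * L < ‖y‖ → G (μ.map fun z => z - y) (-y) = 0 := fun y hy =>
    hG0 _ _ (by rwa [norm_neg])
  -- the four real integrands
  set F₁ : E3 → ℝ := fun y => (transport δ L μ y).toReal with hF₁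
  set F₂ : E3 → ℝ := fun y => (transport δ L (μ.map fun z => z - y) (-y)).toReal with hF₂
  set G₁ : E3 → ℝ := fun y => (G μ y).toReal with hG₁
  set G₂ : E3 → ℝ := fun y => (G (μ.map fun z => z - y) (-y)).toReal with hG₂
  have hF₁m' : Measurable fun y : E3 => transport δ L μ y := by
    have h : Measurable ((Function.uncurry (transport δ L)) ∘ fun y : E3 => (μ, y)) :=
      (measurable_transport δ L).comp (measurable_const.prodMk measurable_id)
    rw [Function.comp_def] at h
    exact h
  have hG₁m' : Measurable fun y : E3 => G μ y := by
    have h : Measurable ((Function.uncurry G) ∘ fun y : E3 => (μ, y)) :=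
      hGm.comp (measurable_const.prodMk measurable_id)
    rw [Function.comp_def] at h
    exact h
  have hF₂m' : Measurable fun y : E3 => transport δ L (μ.map fun z => z - y) (-y) :=
    measurable_transport_map_sub hmem
  have hG₂m' : Measurable fun y : E3 => G (μ.map fun z => z - y) (-y) := measurable_recv hGm hmem
  have hF₁m : Measurable F₁ := hF₁m'.ennreal_toReal
  have hF₂m : Measurable F₂ := hF₂m'.ennreal_toReal
  have hG₁m : Measurable G₁ := hG₁m'.ennreal_toReal
  have hG₂m : Measurable G₂ := hG₂m'.ennreal_toReal
  have hF₁le : ∀ y, F₁ y ≤ Mb := fun y => ENNReal.toReal_mono hDBtop (hsent_le y)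
  have hF₂le : ∀ y ∈ S, F₂ y ≤ Mb := fun y hy => ENNReal.toReal_mono hDBtop (hrecv_le y hy)
  have hG₁le : ∀ y, G₁ y ≤ Kr := fun y => ENNReal.toReal_mono hKtop (hGsent_le y)
  have hG₂le : ∀ y ∈ S, G₂ y ≤ Kr := fun y hy => ENNReal.toReal_mono hKtop (hGrecv_le y hy)
  have hF₁0 : ∀ y, 0 ≤ F₁ y := fun y => ENNReal.toReal_nonneg
  have hF₂0 : ∀ y, 0 ≤ F₂ y := fun y => ENNReal.toReal_nonneg
  have hG₁0 : ∀ y, 0 ≤ G₁ y := fun y => ENNReal.toReal_nonneg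
  have hG₂0 : ∀ y, 0 ≤ G₂ y := fun y => ENNReal.toReal_nonneg
  -- the integrand is `d⁻¹ · ((F₂ + G₂) − (F₁ + G₁))` almost everywhere (on `S`)
  have hcongr : (fun y => (-(d⁻¹ * (min (F₁ y) Mb + min (G₁ y) Kr))) -
      (-(d⁻¹ * (min (F₂ y) Mb + min (G₂ y) Kr)))) =ᵐ[μ]
      fun y => d⁻¹ * ((F₂ y + G₂ y) - (F₁ y + G₁ y)) := by
    refine (ae_restrict_iff' hSm).2 (Eventually.of_forall fun y hy => ?_)
    show -(d⁻¹ * (min (F₁ y) Mb + min (G₁ y) Kr)) - -(d⁻¹ * (min (F₂ y) Mb + min (G₂ y) Kr)) =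
      d⁻¹ * ((F₂ y + G₂ y) - (F₁ y + G₁ y))
    rw [min_eq_left (hF₁le y), min_eq_left (hF₂le y hy), min_eq_left (hG₁le y), min_eq_left (hG₂le y hy)]
    ring
  -- integrability (bounded, supported in the ball of radius `2L`, which has finite mass)
  have hball : μ (Metric.closedBall (0 : E3) (2 * L)) ≠ ∞ :=
    (measure_lt_top_of_mem_hcClass hmem subset_rfl).ne
  have hgM : Integrable ((Metric.closedBall (0 : E3) (2 * L)).indicator fun _ => Mb) μ :=
    (integrableOn_const hball).integrable_indicator measurableSet_closedBall
  have hgK : Integrable ((Metric.closedBall (0 : E3) (2 * L)).indicator fun _ => Kr) μ :=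
    (integrableOn_const hball).integrable_indicator measurableSet_closedBall
  have hbd : ∀ (f : E3 → ℝ) (M : ℝ), (∀ y, 0 ≤ f y) → (∀ y ∈ S, f y ≤ M) → (∀ y : E3, 2 * L < ‖y‖ → f y = 0) →
      ∀ᵐ y ∂μ, ‖f y‖ ≤ (Metric.closedBall (0 : E3) (2 * L)).indicator (fun _ => M) y := by
    intro f M hf0 hfle hf0'
    refine (ae_restrict_iff' hSm).2 (Eventually.of_forall fun y hyS => ?_)
    by_cases hy : y ∈ Metric.closedBall (0 : E3) (2 * L)
    · rw [indicator_of_mem hy, Real.norm_eq_abs, abs_of_nonneg (hf0 y)]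
      exact hfle y hyS
    · rw [indicator_of_notMem hy, Real.norm_eq_abs]
      rw [Metric.mem_closedBall, dist_zero_right, not_le] at hy
      simp [hf0' y hy]
  have hF₁i : Integrable F₁ μ := hgM.mono' hF₁m.aestronglyMeasurable
    (hbd F₁ Mb hF₁0 (fun y _ => hF₁le y) fun y hy => by simp [hF₁, hsent_zero y hy])
  have hF₂i : Integrable F₂ μ := hgM.mono' hF₂m.aestronglyMeasurable
    (hbd F₂ Mb hF₂0 hF₂le fun y hy => by simp [hF₂, hrecv_zero y hy])
  have hG₁i : Integrable G₁ μ := hgK.mono' hG₁m.aestronglyMeasurable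
    (hbd G₁ Kr hG₁0 (fun y _ => hG₁le y) fun y hy => by simp [hG₁, hGsent_zero y hy])
  have hG₂i : Integrable G₂ μ := hgK.mono' hG₂m.aestronglyMeasurable
    (hbd G₂ Kr hG₂0 hG₂le fun y hy => by simp [hG₂, hGrecv_zero y hy])
  have hFG₁i : Integrable (fun y => F₁ y + G₁ y) μ := hF₁i.add hG₁i
  have hFG₂i : Integrable (fun y => F₂ y + G₂ y) μ := hF₂i.add hG₂i
  -- the Bochner integrals are the `lintegral`s OUT and IN
  have hOUT_eq : ∫ y, F₁ y ∂μ = (∫⁻ y, transport δ L μ y ∂μ).toReal :=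
    integral_toReal hF₁m'.aemeasurable (Eventually.of_forall fun y => (hsent_le y).trans_lt hDBtop.lt_top)
  have hIN_eq : ∫ y, F₂ y ∂μ = (∫⁻ y, transport δ L (μ.map fun z => z - y) (-y) ∂μ).toReal :=
    integral_toReal hF₂m'.aemeasurable
      ((ae_restrict_iff' hSm).2 (Eventually.of_forall fun y hy => (hrecv_le y hy).trans_lt hDBtop.lt_top))
  have hOUTG_eq : ∫ y, G₁ y ∂μ = (∫⁻ y, G μ y ∂μ).toReal :=
    integral_toReal hG₁m'.aemeasurable (Eventually.of_forall fun y => (hGsent_le y).trans_lt hKtop.lt_top)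
  have hING_eq : ∫ y, G₂ y ∂μ = (∫⁻ y, G (μ.map fun z => z - y) (-y) ∂μ).toReal :=
    integral_toReal hG₂m'.aemeasurable
      ((ae_restrict_iff' hSm).2 (Eventually.of_forall fun y hy => (hGrecv_le y hy).trans_lt hKtop.lt_top))
  -- OUT and IN: the bounds of the energy-floor proof, and finiteness
  set OUT : ℝ≥0∞ := ∫⁻ y, transport δ L μ y ∂μ with hOUTdef
  set IN : ℝ≥0∞ := ∫⁻ y, transport δ L (μ.map fun z => z - y) (-y) ∂μ with hINdef
  set OUTG : ℝ≥0∞ := ∫⁻ y, G μ y ∂μ with hOUTGdef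
  set ING : ℝ≥0∞ := ∫⁻ y, G (μ.map fun z => z - y) (-y) ∂μ with hINGdef
  set U : ℝ≥0∞ := 6 * ENNReal.ofReal (ρ / L) * ENNReal.ofReal (250 * δ⁻¹ ^ 6) +
    D * ENNReal.ofReal (1000 * δ⁻¹ ^ 4 * ρ⁻¹ ^ 2) with hUdef
  have hUtop : U ≠ ∞ := by
    refine ENNReal.add_ne_top.2 ⟨?_, ENNReal.mul_ne_top hDtop ENNReal.ofReal_ne_top⟩
    exact ENNReal.mul_ne_top (ENNReal.mul_ne_top (by norm_num) ENNReal.ofReal_ne_top) ENNReal.ofReal_ne_top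
  have hOUT : OUT ≤ D * ENNReal.ofReal (rootEnergy' μ + cst δ) + ENNReal.ofReal (1 / 12) * U := by
    calc OUT = ∫⁻ v in phaseDom, ENNReal.ofReal (locEnergy δ μ (rootCell L v) + cst δ) :=
          lintegral_transport_eq hδ hL hμ'
      _ ≤ D * ENNReal.ofReal (rootEnergy' μ + cst δ) + ENNReal.ofReal (1 / 12) * errTerm L μ :=
          setLIntegral_ofReal_locEnergy_le hδ L hμ'
      _ ≤ D * ENNReal.ofReal (rootEnergy' μ + cst δ) + ENNReal.ofReal (1 / 12) * U := by
          gcongr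
          exact errTerm_le_uniform hδ hL hδρ hμ'
  have hRHS_top : D * ENNReal.ofReal (rootEnergy' μ + cst δ) + ENNReal.ofReal (1 / 12) * U ≠ ∞ :=
    ENNReal.add_ne_top.2 ⟨ENNReal.mul_ne_top hDtop ENNReal.ofReal_ne_top,
      ENNReal.mul_ne_top ENNReal.ofReal_ne_top hUtop⟩
  have hOUTtop : OUT ≠ ∞ := ne_top_of_le_ne_top hRHS_top hOUT
  have hINtop : IN ≠ ∞ := by
    have hle : IN ≤ ∫⁻ y, (Metric.closedBall (0 : E3) (2 * L)).indicator (fun _ => D * Bδ) y ∂μ := by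
      refine lintegral_mono_ae ((ae_restrict_iff' hSm).2 (Eventually.of_forall fun y hyS => ?_))
      by_cases hy : y ∈ Metric.closedBall (0 : E3) (2 * L)
      · rw [indicator_of_mem hy]
        exact hrecv_le y hyS
      · rw [indicator_of_notMem hy]
        rw [Metric.mem_closedBall, dist_zero_right, not_le] at hy
        rw [hrecv_zero y hy]
    rw [lintegral_indicator_const measurableSet_closedBall] at hle
    exact ne_top_of_le_ne_top (ENNReal.mul_ne_top hDBtop hball) hle
  have hOUTGtop : OUTG ≠ ∞ := ne_top_of_le_ne_top hINtop (le_add_self.trans hIN)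
  have hINGtop : ING ≠ ∞ := by
    have hle : ING ≤ ∫⁻ y, (Metric.closedBall (0 : E3) (2 * L)).indicator (fun _ => K) y ∂μ := by
      refine lintegral_mono_ae ((ae_restrict_iff' hSm).2 (Eventually.of_forall fun y hyS => ?_))
      by_cases hy : y ∈ Metric.closedBall (0 : E3) (2 * L)
      · rw [indicator_of_mem hy]
        exact hGrecv_le y hyS
      · rw [indicator_of_notMem hy]
        rw [Metric.mem_closedBall, dist_zero_right, not_le] at hy
        rw [hGrecv_zero y hy]
    rw [lintegral_indicator_const measurableSet_closedBall] at hle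
    exact ne_top_of_le_ne_top (ENNReal.mul_ne_top hKtop hball) hle
  -- real-valued consequences
  have hh'C : 0 ≤ rootEnergy' μ + cst δ := by
    have := (rootEnergy'_bounds_of_hc hδ hμ').1
    unfold cst
    linarith
  have hOUTr : OUT.toReal ≤ d * (rootEnergy' μ + cst δ) + 1 / 12 * U.toReal := by
    have := ENNReal.toReal_mono hRHS_top hOUT
    rwa [ENNReal.toReal_add (ENNReal.mul_ne_top hDtop ENNReal.ofReal_ne_top)
      (ENNReal.mul_ne_top ENNReal.ofReal_ne_top hUtop), ENNReal.toReal_mul, ENNReal.toReal_mul,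
      ENNReal.toReal_ofReal hh'C, ENNReal.toReal_ofReal (by norm_num : (0 : ℝ) ≤ 1 / 12)] at this
  have hINr : d * (eStar + cst δ) + OUTG.toReal ≤ IN.toReal := by
    have h1 := ENNReal.toReal_mono hINtop hIN
    rw [ENNReal.toReal_add (ENNReal.mul_ne_top hDtop ENNReal.ofReal_ne_top) hOUTGtop, ENNReal.toReal_mul,
      ENNReal.toReal_ofReal'] at h1
    have h2 := mul_le_mul_of_nonneg_left (le_max_left (eStar + cst δ) 0) hdpos.le
    linarith
  have hUr : U.toReal = 6 * (ρ / L) * (250 * δ⁻¹ ^ 6) + d * (1000 * δ⁻¹ ^ 4 * ρ⁻¹ ^ 2) := by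
    rw [hUdef, ENNReal.toReal_add
      (ENNReal.mul_ne_top (ENNReal.mul_ne_top (by norm_num) ENNReal.ofReal_ne_top) ENNReal.ofReal_ne_top)
      (ENNReal.mul_ne_top hDtop ENNReal.ofReal_ne_top)]
    rw [ENNReal.toReal_mul, ENNReal.toReal_mul, ENNReal.toReal_mul,
      ENNReal.toReal_ofReal (div_nonneg hρ hL.le), ENNReal.toReal_ofReal (by positivity),
      ENNReal.toReal_ofReal (by positivity), ← hd]
    norm_num
  -- the root energy is the measurable root energy
  have hroot : rootEnergy lennardJones μ = rootEnergy' μ := by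
    rw [Literature.MathematicalPhysics.StatisticalMechanics.rootEnergy_def, rootEnergy'_eq_of_hc hδ hμ']
  -- assemble
  rw [integral_congr_ae hcongr, integral_const_mul, integral_sub hFG₂i hFG₁i, integral_add hF₂i hG₂i,
    integral_add hF₁i hG₁i, hOUT_eq, hIN_eq, hOUTG_eq, hING_eq, hroot, ← hUr]
  have hkey : d * (eStar + cst δ) - (d * (rootEnergy' μ + cst δ) + 1 / 12 * U.toReal) + ING.toReal ≤
      (IN.toReal + ING.toReal) - (OUT.toReal + OUTG.toReal) := by linarith
  have hd0 : d ≠ 0 := hdpos.ne'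
  have hcalc : rootEnergy' μ +
      d⁻¹ * (d * (eStar + cst δ) - (d * (rootEnergy' μ + cst δ) + 1 / 12 * U.toReal) + ING.toReal) =
      eStar - U.toReal / (12 * d) + d⁻¹ * ING.toReal := by
    field_simp
    ring
  calc eStar - U.toReal / (12 * d) + d⁻¹ * ING.toReal
      = rootEnergy' μ +
          d⁻¹ * (d * (eStar + cst δ) - (d * (rootEnergy' μ + cst δ) + 1 / 12 * U.toReal) + ING.toReal) :=
        hcalc.symm
    _ ≤ rootEnergy' μ + d⁻¹ * ((IN.toReal + ING.toReal) - (OUT.toReal + OUTG.toReal)) := by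
        gcongr


/-! ## Registered marker -/

/-- Registered sub-goal `stub_capAssembly_part02` (helper part 2/3 of `stub_capAssembly`, line
`octahedral-annulus-mandate`): the pointwise CERTIFICATE WITH AN EXTRA TRANSPORT `certificate`, closed form. -/
theorem stub_capAssembly_part02 : ∀ (δ L ρ : ℝ), 0 < δ → 0 < L → δ ≤ ρ → ∀ (μ : Measure E3), IsRootedHardCore δ μ → ∀ (G : Measure E3 → E3 → ℝ≥0∞) (K : ℝ≥0∞), K ≠ ∞ → Measurable (Function.uncurry G) → (∀ ν : Measure E3, IsRootedHardCore δ ν → ∀ y, G ν y ≤ K) → (∀ (ν : Measure E3) (y : E3), 2 * L < ‖y‖ → G ν y = 0) → volume phaseDom * ENNReal.ofReal (eStar + cst δ) + ∫⁻ y, G μ y ∂μ ≤ ∫⁻ y, transport δ L (μ.map fun z => z - y) (-y) ∂μ → eStar - (6 * (ρ / L) * (250 * δ⁻¹ ^ 6) + (volume phaseDom).toReal * (1000 * δ⁻¹ ^ 4 * ρ⁻¹ ^ 2)) / (12 * (volume phaseDom).toReal) + ((volume phaseDom).toReal)⁻¹ * (∫⁻ y, G (μ.map fun z => z - y) (-y)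 ∂μ).toReal ≤ rootEnergy lennardJones μ + ∫ y, ((-(((volume phaseDom).toReal)⁻¹ * (min (transport δ L μ y).toReal ((volume phaseDom * ENNReal.ofReal (250 / 24 * δ⁻¹ ^ 12 + cst δ)).toReal) + min (G μ y).toReal K.toReal))) - (-(((volume phaseDom).toReal)⁻¹ * (min (transport δ L (Measure.map (fun z => z - y) μ) (-y)).toReal ((volume phaseDom * ENNReal.ofReal (250 / 24 * δ⁻¹ ^ 12 + cst δ)).toReal) + min (G (Measure.map (fun z => z - y) μ) (-y)).toReal K.toReal)))) ∂μ :=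
  fun _ _ _ hδ hL hδρ _ hμ _ _ hK hGm hGle hG0 hIN => certificate hδ hL hδρ hμ hK hGm hGle hG0 hIN

end Summit.AtomisticToContinuum.Crystallization.Theorems.PalmUnimodularRigidityMinimiserShells.CapAssembly

end
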